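import Summits.QuantumFields.YangMills.Theorems.BalabanUVNodesN15KingModelGraphPowerCountingMixedCert

/-!
# BalabanUVNodes ∕ N15 — THE KING-MODEL RUNG (PART Δ-i): **THE «CONNECTED» QUALIFIER IS INESSENTIAL, AND THE NON-NEGATIVE CONDITION IS ALSO AN EQUIVALENCE** —
# every non-empty line set splits off a connected component whose vertices the rest does not touch, the degree is `D(C ⊔ D) = D(C) + D(D) + dV` across such a split,
# so King's subgraph condition on CONNECTED sub-line-sets gives `D(S) > γ₁` (resp. `≥ 0`) for EVERY non-empty `S` when `dV ≥ 0` (the integer certificates of parts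
# Δ-e∕Λ-b∕Δ-h lose nothing by ignoring connectivity); and «every connected subgraph has degree `≥ 0`» ⟺ «`D(H_i) ≥ 0` along every ordering» (as part Δ-f)
# (Track A, DAG node N15 = NE2; FAN-OUT v1.1 §N15 s3 «KING-MODEL RUNG … NE2's analogue DECIDED in the model»)

HONEST FRAMING.  Count-neutral (cell `pub-ymgap`, seat `pub-ymgap-dag-n15-e` g28; `--supports stmt-QuantumFields-27366 --as helper` = K3⁸
`SpineGivenEndpointR13SepCoPHV`).  TEMPLATE LITERATURE: C. King, *The U(1) Higgs model. I. The continuum limit*, Commun. Math. Phys. **102** (1986) 649–677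
[King1986], §3.4 p. 664, §3.5 (3.78) p. 666 (and p. 666 top: «the graph then factorizes into a product of localised subgraphs»).  Parts Δ-a–Δ-h state King's
subgraph condition on CONNECTED non-empty sub-line-sets (King's subgraphs `H_i` split into connected points); the certificates of parts Δ-e∕Λ-b∕Δ-h test ALL
non-empty line sets.  THIS FILE closes the gap between the two (component splitting, additivity of the degree up to `+dV` per extra component) and supplies the
non-negative analogue of part Δ-f's equivalence.  Finite combinatorics; King's U(1)∕`A = 0` model bookkeeping; NOT Bałaban's `G(U)`; NOT a node discharge; nothing
continuum ∕ ℝ⁴ ∕ OS ∕ mass-gap ∕ Clay.  0 `sorry`; standard axioms.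
THE PRINT.  p. 664 [PDF 16]: *«it is necessary that every subgraph have positive degree D»*; p. 666 [PDF 18]: *«The graph then factorizes into a product of localised
subgraphs»*, *«(3.78) … D(H_{m_{i+1}}) ≥ D(H_{m_i})»*.
WHAT THIS FILE PROVES.
* §1 (ns `…Graph`) ★ `lConn_filter_of_lConn` (a chain from `w`'s class stays inside the lines whose source is in `w`'s class), ★ `exists_component` (every non-empty
  `S` has a non-empty CONNECTED `C ⊆ S` with `V(C)` disjoint from `V(S ∖ C)`), `lineVerts_union`, ★ `subDeg_union_of_disjoint` (`D(C ∪ D) = D(C) + D(D) + dV`).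
* §2 ★★ **`lt_subDeg_of_posSubgraphsBy`** (`0 ≤ γ₁`, `0 ≤ dV`: `PosSubgraphsBy γ₁` ⇒ `γ₁ < D(S)` for EVERY non-empty `S`), ★ `subDeg_nonneg_of_nonnegSubgraphs`
  (`0 ≤ dV`), ★ `posSubgraphsBy_iff_forall_nonempty`, ★ `nonnegSubgraphs_iff_forall_nonempty`.
* §3 (ns `…Curved`) `nonnegDegrees_ofFn_imp`, `nonnegDegrees_ofFn_rev_imp_prefix`, ★★ **`nonnegSubgraphs_of_forall_nonnegDegrees`**, ★★
  **`nonnegSubgraphs_iff_forall_nonnegDegrees`** (the non-negative EQUIVALENCE).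
* §4 `nonnegCert_bubble_three` (`decide`), ★ **`king_graph_size_log_bubble_four`** (the 4-dimensional bubble of part Δ-c's census — two parallel `G`-lines, degree
  `4 − 2 − 2 = 0` — is bounded by `Γ·C₁²·C₂·(2!·(k+1)²)·Π q`, part Λ-b).
HONEST SCOPE.  Bookkeeping; nothing about which graphs occur in King's expansion.  Locators: [King1986] p.664, p.666.
-/
noncomputable section

namespace Summit.QuantumFields.YangMills.BalabanUVNodes.N15KingModelRung.Graph

open scoped BigOperators
open Finset

/-! ## §1 Components and the additivity of the degree -/

section Components
variable {nn m : ℕ} {src tgt : Fin m → Fin (nn + 1)}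

/-- ★ **A CHAIN STAYS IN ITS CLASS**: if `u` is joined to `w` through `T` and to `v` through `T`, then `u` is joined to `v` through the lines of `T` whose SOURCE is
joined to `w` — the component of `w` is connected as a line set. [folklore] -/
theorem lConn_filter_of_lConn {T : Finset (Fin m)} {w u v : Fin (nn + 1)} [DecidablePred fun ℓ : Fin m => LConn src tgt T w (src ℓ)]
    (h : LConn src tgt T u v) : LConn src tgt T w u → LConn src tgt (T.filter fun ℓ => LConn src tgt T w (src ℓ)) u v := by
  induction h with
  | rel a b hab =>
      intro hu
      obtain ⟨ℓ, hℓ, ha, hb⟩ := hab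
      refine Relation.EqvGen.rel a b ⟨ℓ, ?_, ha, hb⟩
      rw [mem_filter, ha]
      exact ⟨hℓ, hu⟩
  | refl a => exact fun _ => Relation.EqvGen.refl a
  | symm a b hab ih => exact fun hu => (ih (hu.trans _ _ _ (hab.symm _ _))).symm _ _
  | trans a b c hab _ ih1 ih2 => exact fun hu => (ih1 hu).trans _ _ _ (ih2 (hu.trans _ _ _ hab))

/-- ★ **EVERY NON-EMPTY LINE SET HAS A CONNECTED COMPONENT WHICH THE REST DOES NOT TOUCH**: there is a non-empty `C ⊆ S`, connected as a line set, such that no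
vertex of `C` is a vertex of `S ∖ C`. [cite: King1986, p.666 («factorizes into a product of localised subgraphs»)] -/
theorem exists_component {S : Finset (Fin m)} (hS : S.Nonempty) :
    ∃ C : Finset (Fin m), C ⊆ S ∧ C.Nonempty ∧ (∀ u ∈ lineVerts src tgt C, ∀ v ∈ lineVerts src tgt C, LConn src tgt C u v) ∧
      Disjoint (lineVerts src tgt C) (lineVerts src tgt (S \ C)) := by
  classical
  obtain ⟨ℓ₀, hℓ₀⟩ := hS
  set C := S.filter fun ℓ => LConn src tgt S (src ℓ₀) (src ℓ) with hC
  -- every vertex of `C` is joined to `src ℓ₀` through `S`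
  have hreach : ∀ v ∈ lineVerts src tgt C, LConn src tgt S (src ℓ₀) v := by
    intro v hv
    obtain ⟨ℓ, hℓ, h⟩ := mem_lineVerts.1 hv
    rw [hC, mem_filter] at hℓ
    rcases h with rfl | rfl
    · exact hℓ.2
    · exact hℓ.2.trans _ _ _ (Relation.EqvGen.rel _ _ ⟨ℓ, hℓ.1, rfl, rfl⟩)
  refine ⟨C, filter_subset _ _, ⟨ℓ₀, by rw [hC, mem_filter]; exact ⟨hℓ₀, Relation.EqvGen.refl _⟩⟩, ?_, ?_⟩
  · -- connected as a line set
    intro u hu v hv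
    have huv : LConn src tgt S u v := ((hreach u hu).symm _ _).trans _ _ _ (hreach v hv)
    have h := lConn_filter_of_lConn (T := S) (w := src ℓ₀) huv (hreach u hu)
    rw [hC]
    convert h
  · -- the rest does not touch `V(C)`
    rw [disjoint_left]
    intro v hvC hvR
    obtain ⟨ℓ, hℓ, h⟩ := mem_lineVerts.1 hvR
    rw [mem_sdiff] at hℓ
    have hv := hreach v hvC
    apply hℓ.2
    rw [hC, mem_filter]
    refine ⟨hℓ.1, ?_⟩
    rcases h with rfl | rfl
    · exact hv
    · exact hv.trans _ _ _ (Relation.EqvGen.rel _ _ ⟨ℓ, hℓ.1, rfl, rfl⟩ |>.symm _ _)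

/-- the vertices of a union. [folklore] -/
theorem lineVerts_union (C D : Finset (Fin m)) : lineVerts src tgt (C ∪ D) = lineVerts src tgt C ∪ lineVerts src tgt D := by
  classical
  unfold lineVerts
  rw [image_union, image_union]
  ext v; simp only [mem_union]; tauto

/-- ★ **THE DEGREE ACROSS A SPLIT**: for disjoint line sets with disjoint vertex sets, `D(C ∪ D) = D(C) + D(D) + dV` (the «−1» is paid once per component).
[cite: King1986, (3.66) p.664] -/
theorem subDeg_union_of_disjoint (dV : ℝ) (e : Fin m → ℝ) {C D : Finset (Fin m)} (hCD : Disjoint C D)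
    (hV : Disjoint (lineVerts src tgt C) (lineVerts src tgt D)) :
    subDeg src tgt dV e (C ∪ D) = subDeg src tgt dV e C + subDeg src tgt dV e D + dV := by
  classical
  unfold subDeg
  rw [lineVerts_union, card_union_of_disjoint hV, sum_union hCD, Nat.cast_add]
  ring

end Components

/-! ## §2 From connected sub-line-sets to all sub-line-sets -/

section AllSets
variable {nn m : ℕ} {src tgt : Fin m → Fin (nn + 1)}

/-- ★★ **KING's SUBGRAPH CONDITION ON CONNECTED SETS GIVES IT ON ALL SETS** (`0 ≤ γ₁`, `0 ≤ dV`): every non-empty line set `S` has `D(S) > γ₁` — split off a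
component and induct: `D(S) = D(C) + D(S ∖ C) + dV > γ₁ + γ₁ + 0 ≥ γ₁`. [cite: King1986, p.664, p.666] -/
theorem lt_subDeg_of_posSubgraphsBy {γ₁ dV : ℝ} {e : Fin m → ℝ} (hγ₁ : 0 ≤ γ₁) (hdV : 0 ≤ dV) (hpos : PosSubgraphsBy src tgt γ₁ dV e) :
    ∀ S : Finset (Fin m), S.Nonempty → γ₁ < subDeg src tgt dV e S := by
  classical
  intro S
  induction S using Finset.strongInduction with
  | H S ih =>
      intro hS
      obtain ⟨C, hCS, hC, hconn, hdisj⟩ := exists_component (src := src) (tgt := tgt) hS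
      by_cases hrest : (S \ C).Nonempty
      · have hsplit : S = C ∪ (S \ C) := (union_sdiff_of_subset hCS).symm
        have hlt : S \ C ⊂ S := sdiff_ssubset hCS hC
        have h1 := hpos C hC hconn
        have h2 := ih (S \ C) hlt hrest
        rw [hsplit, subDeg_union_of_disjoint dV e disjoint_sdiff hdisj]
        linarith
      · have hSC : S = C := by
          refine Subset.antisymm (fun ℓ hℓ => ?_) hCS
          by_contra hℓC
          exact hrest ⟨ℓ, mem_sdiff.2 ⟨hℓ, hℓC⟩⟩
        rw [hSC]
        exact hpos C hC hconn

/-- ★ **THE NON-NEGATIVE CONDITION LIKEWISE** (`0 ≤ dV`): every non-empty `S` has `D(S) ≥ 0`. [cite: King1986, (3.78) p.666] -/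
theorem subDeg_nonneg_of_nonnegSubgraphs {dV : ℝ} {e : Fin m → ℝ} (hdV : 0 ≤ dV) (hnn : NonnegSubgraphs src tgt dV e) :
    ∀ S : Finset (Fin m), S.Nonempty → 0 ≤ subDeg src tgt dV e S := by
  classical
  intro S
  induction S using Finset.strongInduction with
  | H S ih =>
      intro hS
      obtain ⟨C, hCS, hC, hconn, hdisj⟩ := exists_component (src := src) (tgt := tgt) hS
      by_cases hrest : (S \ C).Nonempty
      · have hsplit : S = C ∪ (S \ C) := (union_sdiff_of_subset hCS).symm
        have hlt : S \ C ⊂ S := sdiff_ssubset hCS hC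
        have h1 := hnn C hC hconn
        have h2 := ih (S \ C) hlt hrest
        rw [hsplit, subDeg_union_of_disjoint dV e disjoint_sdiff hdisj]
        linarith
      · have hSC : S = C := by
          refine Subset.antisymm (fun ℓ hℓ => ?_) hCS
          by_contra hℓC
          exact hrest ⟨ℓ, mem_sdiff.2 ⟨hℓ, hℓC⟩⟩
        rw [hSC]
        exact hnn C hC hconn

/-- ★ **THE CONDITION MAY BE TESTED ON ALL NON-EMPTY LINE SETS** (`0 ≤ γ₁`, `0 ≤ dV`). [cite: King1986, p.664] -/
theorem posSubgraphsBy_iff_forall_nonempty {γ₁ dV : ℝ} {e : Fin m → ℝ} (hγ₁ : 0 ≤ γ₁) (hdV : 0 ≤ dV) :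
    PosSubgraphsBy src tgt γ₁ dV e ↔ ∀ S : Finset (Fin m), S.Nonempty → γ₁ < subDeg src tgt dV e S :=
  ⟨lt_subDeg_of_posSubgraphsBy hγ₁ hdV, fun h S hS _ => h S hS⟩

/-- ★ the non-negative condition likewise (`0 ≤ dV`). [cite: King1986, (3.78) p.666] -/
theorem nonnegSubgraphs_iff_forall_nonempty {dV : ℝ} {e : Fin m → ℝ} (hdV : 0 ≤ dV) :
    NonnegSubgraphs src tgt dV e ↔ ∀ S : Finset (Fin m), S.Nonempty → 0 ≤ subDeg src tgt dV e S :=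
  ⟨subDeg_nonneg_of_nonnegSubgraphs hdV, fun h S hS _ => h S hS⟩

/-- **THE 4-DIMENSIONAL BUBBLE HAS NON-NEGATIVE SUBGRAPH DEGREES** (`d = 3`: `2|S| + 4 ≤ 4|V(S)| = 8` for `|S| = 1, 2`; degrees `2, 0`), by `decide`.
[cite: King1986, p.664] -/
theorem nonnegCert_bubble_three :
    ∀ S : Finset (Fin 2), S.Nonempty → (3 - 1) * S.card + 3 + 1 ≤ (3 + 1) * (lineVerts bubSrc bubTgt S).card := by decide

end AllSets

end Summit.QuantumFields.YangMills.BalabanUVNodes.N15KingModelRung.Graph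

namespace Summit.QuantumFields.YangMills.BalabanUVNodes.N15KingModelRung.Curved

open scoped BigOperators
open Finset
open Literature.MathematicalPhysics.QuantumFieldTheory.Balaban1983to89.B5Prop11Plancherel (Tor fine unitVec)
open Summit.QuantumFields.YangMills.BalabanUVNodes.N15KingModelRung.Graph

variable (L : ℕ)

/-! ## §3 The non-negative equivalence: «every connected subgraph has degree ≥ 0» ⟺ «D(H_i) ≥ 0 along every ordering» -/

section NonnegIff

omit L in
/-- `NonnegDegrees (List.ofFn h)` gives every suffix sum `≥ 0`. [cite: King1986, (3.78) p.666] -/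
theorem nonnegDegrees_ofFn_imp :
    ∀ {n : ℕ} (h : Fin n → ℝ), NonnegDegrees (List.ofFn h) → ∀ p : Fin n, 0 ≤ ∑ q ∈ (univ : Finset (Fin n)).filter (fun q : Fin n => p ≤ q), h q
  | 0, _, _, p => Fin.elim0 p
  | n + 1, h, H, p => by
      rw [List.ofFn_succ] at H
      obtain ⟨h1, h2⟩ := H
      refine Fin.cases ?_ (fun p' => ?_) p
      · have hall : (univ : Finset (Fin (n + 1))).filter (fun q : Fin (n + 1) => (0 : Fin (n + 1)) ≤ q) = univ :=
          filter_true_of_mem fun q _ => Fin.zero_le q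
        rw [hall, Fin.sum_univ_succ, ← List.sum_ofFn]
        exact h1
      · have hp := nonnegDegrees_ofFn_imp (fun i : Fin n => h i.succ) h2 p'
        rw [sum_filter, Fin.sum_univ_succ, if_neg (not_le.2 (Fin.succ_pos p')), zero_add]
        rw [sum_filter] at hp
        refine le_of_le_of_eq hp (sum_congr rfl fun i _ => ?_)
        simp only [Fin.succ_le_succ_iff]

omit L in
/-- the prefix form for the reversed list. [cite: King1986, (3.78) p.666] -/
theorem nonnegDegrees_ofFn_rev_imp_prefix {m : ℕ} (g : Fin m → ℝ) (H : NonnegDegrees (List.ofFn fun p : Fin m => g (Fin.rev p)))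
    {i : ℕ} (hi : 1 ≤ i) (him : i ≤ m) : 0 ≤ ∑ q ∈ (univ : Finset (Fin m)).filter (fun q : Fin m => ((q : ℕ)) < i), g q := by
  have hp : m - i < m := by omega
  have h := nonnegDegrees_ofFn_imp (fun p : Fin m => g (Fin.rev p)) H ⟨m - i, hp⟩
  rw [sum_filter_le_comp_rev g ⟨m - i, hp⟩] at h
  have hmi : m - (m - i) = i := by omega
  simp only [hmi] at h
  exact h

variable {nn m : ℕ} {src tgt : Fin m → Fin (nn + 1)}

omit L in
/-- ★★ **NON-NEGATIVE `D(H_i)` ALONG EVERY ORDERING GIVES NON-NEGATIVE CONNECTED SUBGRAPH DEGREES** (read the ordering listing `S` first, part Δ-f).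
[cite: King1986, (3.78) p.666] -/
theorem nonnegSubgraphs_of_forall_nonnegDegrees {dV : ℝ} {e : Fin m → ℝ}
    (h : ∀ π : Equiv.Perm (Fin m), NonnegDegrees (kingDegList src tgt dV e π)) : NonnegSubgraphs src tgt dV e := by
  intro S hS hc
  have hm : S.card ≤ m := by simpa using S.card_le_univ
  have h1 : 1 ≤ S.card := card_pos.2 hS
  have H := h (prefixPerm S)
  rw [kingDegList_eq_ofFn] at H
  have hle := nonnegDegrees_ofFn_rev_imp_prefix
    (fun q : Fin m => e (prefixPerm S q) + if IsTreePos src tgt (prefixPerm S) q then dV else 0) H h1 hm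
  rw [kingDegList_prefix_eq_prefixDeg, prefixDeg_eq_subDeg_of_connected dV e (prefixLines_prefixPerm S) hS hc] at hle
  exact hle

omit L in
/-- ★★ **THE NON-NEGATIVE EQUIVALENCE**: «every non-empty connected sub-line-set has degree `≥ 0`» ⟺ «`D(H_i) ≥ 0` along every ordering». [cite: King1986, (3.78) p.666] -/
theorem nonnegSubgraphs_iff_forall_nonnegDegrees {dV : ℝ} {e : Fin m → ℝ} :
    NonnegSubgraphs src tgt dV e ↔ ∀ π : Equiv.Perm (Fin m), NonnegDegrees (kingDegList src tgt dV e π) :=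
  ⟨fun h π => nonnegDegrees_kingDegList_of_nonnegSubgraphs h π, nonnegSubgraphs_of_forall_nonnegDegrees⟩

end NonnegIff

/-! ## §4 The four-dimensional bubble up to logarithms -/

section BubbleFour
variable [NeZero L]

/-- ★ **THE FOUR-DIMENSIONAL BUBBLE IS BOUNDED BY `const·(k+1)²`** (`d = 3`): two parallel `G`-lines between the external vertex and one internal vertex — degree
`4 − 2 − 2 = 0`, part Δ-c's `not_posSubgraphsBy_bubble_four` — `|E^{(k)}| ≤ Γ·C₁²·C₂·(2!·(k+1)²)·Π q` (part Λ-b). [cite: King1986, p.664, p.666] -/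
theorem king_graph_size_log_bubble_four (hLodd : Odd L) (hL : 2 ≤ L) {a : ℝ} (ha : 0 < a) {m0sq : ℝ} (hm0 : 0 ≤ m0sq) :
    ∃ C₁ C₂ : ℝ, 0 < C₁ ∧ 0 < C₂ ∧ ∀ (k eM : ℕ) (hk : 1 ≤ k) (M : Fin (3 + 1) → ℕ) [∀ μ, NeZero (M μ)] (hM : ∀ μ, M μ = 2 * L ^ eM)
      (msq : ℝ), 0 < msq → msq ≤ m0sq →
      ∀ (Υ : Type) [Fintype Υ] [DecidableEq Υ] (vtx : Υ → Fin (1 + 1)) (u : Υ → Tor (fine (L ^ k) M) → ℝ) (q : Υ → ℝ) (υ₀ : Υ) (Γ : ℝ),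
        vtx υ₀ = 0 → (∀ υ, υ ≠ υ₀ → ∀ x, |u υ x| ≤ q υ) → (∑ x, (((L : ℝ) ^ k)⁻¹) ^ (3 + 1) * |u υ₀ x| ≤ Γ) →
          |graphValLS ((((L : ℝ) ^ k)⁻¹) ^ (3 + 1)) bubSrc bubTgt (fun _ => kingGLine L M a msq k none) vtx u|
            ≤ Γ * (C₁ ^ 2 * C₂ ^ 1 * (((Nat.factorial 2 : ℕ) : ℝ) * ((k : ℝ) + 1) ^ 2) * ∏ υ ∈ univ.erase υ₀, q υ) := by
  obtain ⟨C₁, C₂, hC₁, hC₂, H⟩ := king_graph_size_log_zeroField_subgraphs (d := 3) L hLodd hL ha hm0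
  refine ⟨C₁, C₂, hC₁, hC₂, fun k eM hk M _ hM msq hm hcap Υ _ _ vtx u q υ₀ Γ hυ₀ hq hΓ => ?_⟩
  have hsub : NonnegSubgraphs bubSrc bubTgt ((3 + 1 : ℕ) : ℝ) (fun ℓ => lineExp (3 + 1) ((fun _ : Fin 2 => (none : Option (Fin (3 + 1)))) ℓ)) := by
    rw [show (fun ℓ => lineExp (3 + 1) ((fun _ : Fin 2 => (none : Option (Fin (3 + 1)))) ℓ)) = fun _ => (2 : ℝ) - ((3 + 1 : ℕ) : ℝ)
      from funext fun _ => lineExp_none]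
    exact nonnegSubgraphs_GLines_of_cert (by norm_num) nonnegCert_bubble_three
  exact H k eM hk M hM msq hm hcap 1 2 bubSrc bubTgt lConn_bubble (fun _ => none) hsub Υ vtx u q υ₀ Γ hυ₀ hq hΓ

end BubbleFour

end Summit.QuantumFields.YangMills.BalabanUVNodes.N15KingModelRung.Curved

end
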